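import Summits.BirchSwinnertonDyer.BirchSwinnertonDyer.Theorems.SignedLowerHalvesSmallImageLowerHalfBothSignsRttCharRoadE1CoresNaturality
import Literature.NumberTheory.EllipticCurves.PeriodIndexCorestrictionLocal
import HarnessLib

/-!
# Route `SignedLowerHalves`, crux L `SmallImageLowerHalfBothSigns` (stmt-BirchSwinnertonDyer-23599), line `rtt_w3` v12 — glue `charRoad_injTop`,
# LEAD lemma «the index-two corestriction commutes with restriction down the tower when the coset representative is shared»

WHY: in the ∞-level design of the composition `injTop_of_inputs` (`Lines/rtt_w3-GLUE-g7.md`, INPUT SPEC of 2026-08-30) the coordinate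
classes are `cor_∞ (…)` on `Γ_{ℚ_∞} = κ.kerSubgroup`, while the descent bricks (p767713, p768350, p768739) produce `res_∞ (cor_n (…))` from a
layer-`n` representative. The two agree because the transversal `{1, c}` of `Γ_{K_n}` in `Γ_{ℚ_n}` can be taken inside `Γ_{ℚ_∞}` (a local
element at `p` moving `K_v`, `v ∣ p` inert), and then Neukirch–Schmidt–Wingberg's explicit transfer formula restricts verbatim.

WHAT: `corFun_inclusion` (value level) and ★ `resOfLe_corH1_eq_corH1_resH1Hom` (class level): for subgroups `L' ≤ L` of a topological group `Γ`,
open normal `N ≤ L`, `N' ≤ L'` with `N' = N ∩ L'` and a shared representative `c ∈ L'` of the non-trivial coset on both levels,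
`res_{L'}^{L} (cor_{N}^{L} ξ) = cor_{N'}^{L'} (res_{N'}^{N} ξ)`. THEOREMS ONLY; generic (no curve). [cite: NeukirchSchmidtWingberg2008, I §5 (1.5.7)]
[cite: SerreGaloisCohomology1997, I §2.4]
-/

set_option linter.dupNamespace false -- D-0017: single-problem summit, the namespace repeats the problem name by design

universe u

open scoped Classical

open Literature.NumberTheory.EllipticCurves Literature.NumberTheory.GaloisRepresentations

namespace Summit.BirchSwinnertonDyer.BirchSwinnertonDyer.Theorems.SmallImageCharSignedSelmer

variable {Γ : Type u} [Group Γ] [TopologicalSpace Γ] [IsTopologicalGroup Γ] {L L' : Subgroup Γ}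
  {M : Type u} [AddCommGroup M] [DistribMulAction Γ M] [TopologicalSpace M] [DiscreteTopology M]
  {N : Subgroup L} [N.Normal] {N' : Subgroup L'} [N'.Normal] {c : L} {c' : L'}

/-- **The transfer formula restricts verbatim** (value level): with `N' = N ∩ L'` and the same coset representative `c = c' ∈ L'`, for a cocycle
`f` on `N` and its restriction `f'` to `N'`, `corFun f (g') = corFun f' g'` for every `g' ∈ L'`. [cite: NeukirchSchmidtWingberg2008, I §5 (1.5.7)] -/
theorem corFun_inclusion (h : L' ≤ L) (hcc' : (c : Γ) = (c' : Γ))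
    (hc : ∀ b : L, Xor (b * c⁻¹ ∈ N) (b ∈ N)) (hc' : ∀ b : L', Xor (b * c'⁻¹ ∈ N') (b ∈ N'))
    (hNN' : ∀ b : L', b ∈ N' ↔ Subgroup.inclusion h b ∈ N)
    (i : N' →ₜ* N) (hi : ∀ x : N', ((i x : N) : L) = Subgroup.inclusion h (x : L'))
    (f : contOneCocycles (discreteTopRep N M)) (f' : contOneCocycles (discreteTopRep N' M)) (hf' : ∀ x : N', f'.1 x = f.1 (i x))
    (g' : L') : corFun hc f (Subgroup.inclusion h g') = corFun hc' f' g' := by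
  -- bookkeeping: the two levels see the same elements of `Γ`
  have hincl_mul_inv : Subgroup.inclusion h (g' * c'⁻¹) = Subgroup.inclusion h g' * c⁻¹ := by
    apply Subtype.ext
    simp only [Subgroup.coe_inclusion, Subgroup.coe_mul, Subgroup.coe_inv, hcc']
  have hsmul : ∀ (x : L') (m : M), (Subgroup.inclusion h x) • m = x • m := fun x m ↦ by
    rw [Subgroup.smul_def, Subgroup.smul_def, Subgroup.coe_inclusion]
  have hcsmul : ∀ m : M, c • m = c' • m := fun m ↦ by rw [Subgroup.smul_def, Subgroup.smul_def, hcc']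
  have hconj : ∀ x : N', i (subgroupConj N' c' x) = subgroupConj N c (i x) := fun x ↦ by
    apply Subtype.ext
    rw [hi]
    apply Subtype.ext
    simp only [Subgroup.coe_inclusion, subgroupConj_apply_coe, Subgroup.coe_mul, Subgroup.coe_inv, hi, hcc']
  have hcSq : i (cSq hc') = cSq hc := by
    apply Subtype.ext
    rw [hi]
    apply Subtype.ext
    simp only [Subgroup.coe_inclusion, cSq_coe, Subgroup.coe_mul, hcc']
  have hsym : ∀ x : N', (symCocycle c' f').1 x = (symCocycle c f).1 (i x) := fun x ↦ by
    rw [symCocycle_apply, symCocycle_apply, hf', hf', hconj, hcsmul]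
  by_cases hg : g' ∈ N'
  · have hgN : Subgroup.inclusion h g' ∈ N := (hNN' g').1 hg
    rw [corFun, dif_pos hgN, corFun, dif_pos hg, hsym]
    congr 1
    exact (Subtype.ext (hi ⟨g', hg⟩)).symm
  · have hgN : Subgroup.inclusion h g' ∉ N := fun h' ↦ hg ((hNN' g').2 h')
    rw [corFun, dif_neg hgN, corFun, dif_neg hg, hsym, hf', hcSq, ← hsmul (g' * c'⁻¹)]
    have e1 : (⟨Subgroup.inclusion h g' * c⁻¹, mul_inv_mem_of_not_mem hc hgN⟩ : N) = i ⟨g' * c'⁻¹, mul_inv_mem_of_not_mem hc' hg⟩ :=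
      Subtype.ext (by rw [hi, hincl_mul_inv])
    rw [e1, hincl_mul_inv]

/-- ★ **Corestriction commutes with restriction down the tower (shared transversal)**: for subgroups `L' ≤ L` of `Γ`, open normal `N ≤ L` and
`N' = N ∩ L' ≤ L'`, a discrete `Γ`-module `M` and a common representative `c = c' ∈ L'` of the non-trivial cosets,
`res^{L}_{L'} (cor^{L}_{N} ξ) = cor^{L'}_{N'} (res^{N}_{N'} ξ)` in `H¹(L', M)` (degenerate case of the double coset formula, `L = N·L'`).
[cite: NeukirchSchmidtWingberg2008, I §5 (1.5.7)] [cite: SerreGaloisCohomology1997, I §2.4] -/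
theorem resOfLe_corH1_eq_corH1_resH1Hom (h : L' ≤ L) (hcc' : (c : Γ) = (c' : Γ))
    (hN : IsOpen (N : Set L)) (hN' : IsOpen (N' : Set L'))
    (hM : ∀ m : M, Continuous fun g : L ↦ g • m) (hM' : ∀ m : M, Continuous fun g : L' ↦ g • m)
    (hc : ∀ b : L, Xor (b * c⁻¹ ∈ N) (b ∈ N)) (hc' : ∀ b : L', Xor (b * c'⁻¹ ∈ N') (b ∈ N'))
    (hNN' : ∀ b : L', b ∈ N' ↔ Subgroup.inclusion h b ∈ N)
    (i : N' →ₜ* N) (hi : ∀ x : N', ((i x : N) : L) = Subgroup.inclusion h (x : L'))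
    (hiM : ∀ (x : N') (m : M), AddMonoidHom.id M (i x • m) = x • AddMonoidHom.id M m) (ξ : subgroupH1 N M) :
    resOfLe M h (corH1 hN hM hc ξ) = corH1 hN' hM' hc' (resH1Hom i (AddMonoidHom.id M) hiM ξ) := by
  obtain ⟨f, rfl⟩ := oneCocycleClass_surjective _ ξ
  rw [corH1_oneCocycleClass, resOfLe, resH1Hom_oneCocycleClass, resH1Hom_oneCocycleClass, corH1_oneCocycleClass]
  congr 1
  apply Subtype.ext
  ext g'
  change (corCocycle hN hM hc f).1 (subgroupInclusion h g') = (corCocycle hN' hM' hc' _).1 g'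
  rw [corCocycle_apply, corCocycle_apply]
  exact corFun_inclusion h hcc' hc hc' hNN' i hi f _ (fun x ↦ rfl) g'

end Summit.BirchSwinnertonDyer.BirchSwinnertonDyer.Theorems.SmallImageCharSignedSelmer
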